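import Mathlib
import Summits.NavierStokesRegularity.NavierStokesRegularity.Theorems.LerayQuarterDissipationFiniteDissipationLiouvilleLambProductCollar
import Summits.NavierStokesRegularity.NavierStokesRegularity.Theorems.LerayQuarterDissipationFiniteDissipationLiouvilleCalmSliceForward
import HarnessLib

/-!
# Crux `FiniteDissipationLiouville` (stmt-NavierStokesRegularity-22144): THE ENDPOINT SCHEME IN THE FAR
# PAST — a hypothesis holding only for `t ≤ τ` already forces `V ≡ 0` (zoom-OUT with an eventual
# hypothesis, then forward uniqueness)

Theorems file of route `LerayQuarterDissipation` (lead prover g18; `--supports` the crux; sequel of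
`…EndpointScheme(Slack)`, `…LambProductCollar`, companion of `…EndpointSchemeApex`). Navier–Stokes
regularity is NOT proved by anything here; no summit is.

* `tendsto_atBot_of_antitoneOn_Iic` — an antitone-on-`(−∞, s₀]` function bounded above converges at `−∞`
  to a value dominating it on `(−∞, s₀]`;
* `eq_zero_of_const_slices_until` — a KNSS-gauge Type-I field whose slices are spatially CONSTANT for
  all `t ≤ τ` (`τ < 0`) vanishes identically: the time-shift `t ↦ V(t + τ)` is a class member with
  constant slices, killed by the gauge (`IsTypeIAncientMild.eq_zero_of_slice_const`), and forward
  uniqueness from the zero slice at `τ` (`…CalmSlice.eq_zero_after_zero_slice`) does the rest;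
* **`eq_zero_of_farPast_scheme`** — THE FAR-PAST SCHEME: let `P τ` («the hypothesis holds on `t ≤ τ`»)
  satisfy (i) `P τ V → P (τ/c²) V_c`, (ii) eventual closedness along `…Compactness.seqLimit` with
  thresholds `τ_j → 0⁻` (every `t < 0` is eventually below `τ_j`), giving the all-time property `P∞`,
  (iii) `P τ V` ⇒ the global similarity enstrophy is antitone on `(−∞, −log(−τ)]`, (iv) `P∞` + constant
  enstrophy kills. Then every KNSS-gauge Type-I field with a Type-I envelope and `P τ` for some
  `τ < 0` VANISHES IDENTICALLY (zoom-out limit has `P∞` and the supremal constant enstrophy ⇒ it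
  vanishes ⇒ the supremum is `0` ⇒ the vorticity vanishes for `t ≤ τ` ⇒ `eq_zero_of_const_slices_until`).

HONEST FRAMING. Bookkeeping about HYPOTHETICAL objects: hypotheses at LARGE scales / the far past of an
ancient solution suffice for the Liouville conclusions of this line; for the scaling-recurrent critical
element of the crux nothing new follows. Nothing is removed from the DSS wall. Nothing here bears on
Navier–Stokes regularity.

References: Koch–Nadirashvili–Seregin–Šverák, Acta Math. 203 (2009) §4 (compactness; uniqueness of
bounded mild solutions); folklore energy method.
-/

noncomputable section

set_option linter.dupNamespace false

namespace Summit.NavierStokesRegularity.NavierStokesRegularity.Theorems.FiniteDissipationLiouville.EndpointScheme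

open MeasureTheory Set Filter Topology Metric InnerProductSpace Function Real
open scoped RealInnerProductSpace ContDiff
open Literature.Analysis Literature.Analysis.FluidPDE
open Summit.NavierStokesRegularity.NavierStokesRegularity.Theorems
open Summit.NavierStokesRegularity.NavierStokesRegularity.Theorems.GaussianGap
open Summit.NavierStokesRegularity.NavierStokesRegularity.Theorems.SimilarityEnstrophy
open Summit.NavierStokesRegularity.NavierStokesRegularity.Theorems.RecurrentReductionD
open Summit.NavierStokesRegularity.NavierStokesRegularity.Theorems.FiniteDissipationLiouville
open Summit.NavierStokesRegularity.NavierStokesRegularity.Theorems.FiniteDissipationLiouville.CrossFlow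
open Summit.NavierStokesRegularity.NavierStokesRegularity.Theorems.FiniteDissipationLiouville.LambProduct

/-- An antitone-on-`(−∞, s₀]` real function bounded above there converges at `−∞`, to a value that
dominates it on `(−∞, s₀]`. [folklore] -/
theorem tendsto_atBot_of_antitoneOn_Iic {Z : ℝ → ℝ} {s₀ B : ℝ} (hanti : AntitoneOn Z (Iic s₀))
    (hB : ∀ s, s ≤ s₀ → Z s ≤ B) :
    ∃ m : ℝ, Tendsto Z atBot (𝓝 m) ∧ ∀ s, s ≤ s₀ → Z s ≤ m := by
  set f : ℝ → ℝ := fun σ => Z (min σ s₀) with hf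
  have hfanti : Antitone f := by
    intro σ σ' h
    exact hanti (min_le_right σ s₀) (min_le_right σ' s₀) (min_le_min h le_rfl)
  have hbdd : BddAbove (range f) := ⟨B, by rintro _ ⟨σ, rfl⟩; exact hB _ (min_le_right _ _)⟩
  refine ⟨⨆ σ, f σ, ?_, fun s hs => ?_⟩
  · have h := tendsto_atBot_ciSup hfanti hbdd
    refine h.congr' ?_
    filter_upwards [eventually_le_atBot s₀] with σ hσ
    rw [hf]; dsimp only; rw [min_eq_left hσ]
  · have : f s = Z s := by rw [hf]; dsimp only; rw [min_eq_left hs]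
    rw [← this]; exact le_ciSup hbdd s

variable {C : ℝ}

/-- **Constant slices on a past half-line force `V ≡ 0`.** If a KNSS-gauge Type-I field has spatially
constant slices `V(t,·) = V(t,0)` for all `t ≤ τ` (`τ < 0`), then `V ≡ 0` on `t < 0`: the time-shift
`t ↦ V(t + τ)` (a class member, `IsTypeIAncientMild.comp_sub_right`) has constant slices for ALL `t < 0`,
so it vanishes (`eq_zero_of_slice_const`); hence `V(τ) = 0` and forward uniqueness
(`…CalmSlice.eq_zero_after_zero_slice`) kills the rest. [cite: KochNadirashviliSereginSverak2009, Remark 6.1 and §4 (arXiv:0709.3599)] -/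
theorem eq_zero_of_const_slices_until {V : ℝ → EuclideanSpace ℝ (Fin 3) → EuclideanSpace ℝ (Fin 3)}
    (hV : IsTypeIAncientMild C V) {τ : ℝ} (hτ : τ < 0)
    (hconst : ∀ t : ℝ, t ≤ τ → ∀ x, V t x = V t 0) : ∀ t < 0, ∀ x, V t x = 0 := by
  -- the shifted field `V' t = V (t - (-τ)) = V (t + τ)`
  have hV' : IsTypeIAncientMild C (fun t => V (t - (-τ))) := hV.comp_sub_right (by linarith)
  have hzero' : ∀ t < 0, ∀ x, V (t - (-τ)) x = 0 :=
    fun t ht x => hV'.eq_zero_of_slice_const (b := fun t => V (t - (-τ)) 0)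
      (fun t' ht' x' => hconst _ (by linarith) x') ht x
  -- hence `V ≡ 0` on `t < τ` and at `τ` (continuity is not needed: take `t ≤ τ` via `t' = t + ... `)
  have hpast : ∀ t : ℝ, t < τ → ∀ x, V t x = 0 := by
    intro t ht x
    have h := hzero' (t - τ) (by linarith) x
    simp only [sub_neg_eq_add, sub_add_cancel] at h
    exact h
  -- the slice `τ' := τ − 1 < τ` vanishes; forward uniqueness from there
  intro t ht x
  rcases lt_or_ge t τ with hlt | hge
  · exact hpast t hlt x
  · have h0 : ∀ y, V (τ - 1) y = 0 := fun y => hpast _ (by linarith) y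
    exact CalmSlice.eq_zero_after_zero_slice hV h0 ⟨by linarith, ht⟩ x

/-- **THE FAR-PAST SCHEME.** See the module docstring. `P : ℝ → (field → Prop)` is the family «the
hypothesis holds for `t ≤ τ`», `Pinf` the all-time property. [folklore energy method + KNSS compactness] -/
theorem eq_zero_of_farPast_scheme
    {P : ℝ → (ℝ → EuclideanSpace ℝ (Fin 3) → EuclideanSpace ℝ (Fin 3)) → Prop}
    {Pinf : (ℝ → EuclideanSpace ℝ (Fin 3) → EuclideanSpace ℝ (Fin 3)) → Prop}
    (hscale : ∀ (V : ℝ → EuclideanSpace ℝ (Fin 3) → EuclideanSpace ℝ (Fin 3)) (c τ : ℝ), 0 < c →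
      P τ V → P (τ / c ^ 2) (nsRescale c V))
    (hclosed : ∀ (u : ℕ → ℝ → EuclideanSpace ℝ (Fin 3) → EuclideanSpace ℝ (Fin 3))
        (W : ℝ → EuclideanSpace ℝ (Fin 3) → EuclideanSpace ℝ (Fin 3)) (τ : ℕ → ℝ),
      (∀ j, IsTypeIAncientMild C (u j)) → (∀ j, HasTypeIDecay C (u j)) → (∀ j, P (τ j) (u j)) →
      (∀ j, τ j < 0) → Tendsto τ atTop (𝓝 0) → IsTypeIAncientMild C W →
      (∀ n : ℕ, TendstoUniformlyOn (fun j z => u j z.1 z.2) (fun z => W z.1 z.2) atTop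
        (Icc (-((n : ℝ) + 2)) (-(1 / ((n : ℝ) + 2))) ×ˢ
          closedBall (0 : EuclideanSpace ℝ (Fin 3)) ((n : ℝ) + 2))) →
      (∀ t < 0, ∀ x, Tendsto (fun j => u j t x) atTop (𝓝 (W t x))) →
      (∀ t < 0, ∀ x, Tendsto (fun j => fderiv ℝ (u j t) x) atTop (𝓝 (fderiv ℝ (W t) x))) →
      Pinf W)
    (hanti : ∀ (V : ℝ → EuclideanSpace ℝ (Fin 3) → EuclideanSpace ℝ (Fin 3)) (τ : ℝ),
      IsTypeIAncientMild C V → HasTypeIDecay C V → τ < 0 → P τ V →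
      AntitoneOn (fun σ => ∫ y, ‖lerayVorticity V σ y‖ ^ 2) (Iic (-Real.log (-τ))))
    (hconst : ∀ (V : ℝ → EuclideanSpace ℝ (Fin 3) → EuclideanSpace ℝ (Fin 3)),
      IsTypeIAncientMild C V → HasTypeIDecay C V → Pinf V →
      (∀ s s' : ℝ, (∫ y, ‖lerayVorticity V s y‖ ^ 2) = ∫ y, ‖lerayVorticity V s' y‖ ^ 2) →
      ∀ t < 0, ∀ x, V t x = 0)
    {V : ℝ → EuclideanSpace ℝ (Fin 3) → EuclideanSpace ℝ (Fin 3)}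
    (hV : IsTypeIAncientMild C V) (hdec : HasTypeIDecay C V) {τ : ℝ} (hτ : τ < 0) (hP : P τ V) :
    ∀ t < 0, ∀ x, V t x = 0 := by
  obtain ⟨C₁, C₂, C₃, hD1, hD2, -⟩ := IsTypeIAncientMild.gaugeBounds_of_hasTypeIDecay hV hdec
  -- the enstrophy: antitone on `(−∞, s₀]`, bounded above, hence convergent at `−∞`
  obtain ⟨Z, hZdef⟩ : ∃ Z : ℝ → ℝ, Z = fun σ => ∫ y, ‖lerayVorticity V σ y‖ ^ 2 := ⟨_, rfl⟩
  have hZσ : ∀ σ, Z σ = ∫ y, ‖lerayVorticity V σ y‖ ^ 2 := fun σ => by rw [hZdef]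
  set s₀ : ℝ := -Real.log (-τ) with hs₀
  have hantiZ : AntitoneOn Z (Iic s₀) := by rw [hZdef]; exact hanti V τ hV hdec hτ hP
  -- a global bound from the class decay
  have hcontB : Continuous fun y : EuclideanSpace ℝ (Fin 3) =>
      (‖curlCLM‖ * C₁) ^ 2 * (1 + ‖y‖) ^ (-(4 : ℝ)) :=
    continuous_const.mul ((continuous_const.add continuous_norm).rpow_const
      fun y => Or.inl (add_pos_of_pos_of_nonneg one_pos (norm_nonneg y)).ne')
  have imaj : Integrable fun y : EuclideanSpace ℝ (Fin 3) =>
      (‖curlCLM‖ * C₁) ^ 2 * (1 + ‖y‖) ^ (-(4 : ℝ)) :=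
    integrable_of_le_decay_four hcontB (K := (‖curlCLM‖ * C₁) ^ 2) fun y => by
      rw [Real.norm_of_nonneg (by positivity)]
  have hZB : ∀ σ, Z σ ≤ ∫ y : EuclideanSpace ℝ (Fin 3), (‖curlCLM‖ * C₁) ^ 2 * (1 + ‖y‖) ^ (-(4 : ℝ)) := by
    intro σ
    rw [hZσ]
    refine integral_mono (integrable_norm_lerayVorticity_sq hV hD1 σ) imaj fun y => ?_
    have h := norm_lerayVorticity_le_decay hV hD1 σ y
    calc ‖lerayVorticity V σ y‖ ^ 2 ≤ (‖curlCLM‖ * C₁ * (1 + ‖y‖) ^ (-(2 : ℝ))) ^ 2 :=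
          pow_le_pow_left₀ (norm_nonneg _) h 2
      _ = (‖curlCLM‖ * C₁) ^ 2 * ((1 + ‖y‖) ^ (-(2 : ℝ)) * (1 + ‖y‖) ^ (-(2 : ℝ))) := by ring
      _ = (‖curlCLM‖ * C₁) ^ 2 * (1 + ‖y‖) ^ (-(4 : ℝ)) := by
          rw [← Real.rpow_add (by positivity)]; norm_num
  obtain ⟨m, hm, hmle⟩ := tendsto_atBot_of_antitoneOn_Iic hantiZ fun s _ => hZB s
  -- the zoom-OUT sequence and its KNSS limit
  obtain ⟨u, hudef⟩ : ∃ u : ℕ → ℝ → EuclideanSpace ℝ (Fin 3) → EuclideanSpace ℝ (Fin 3),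
      ∀ j, u j = nsRescale (Real.exp (j : ℝ)) V := ⟨_, fun j => rfl⟩
  have hu : ∀ j, IsTypeIAncientMild C (u j) := fun j => by
    rw [hudef]; exact hV.nsRescale (Real.exp_pos _)
  have hdu : ∀ j, HasTypeIDecay C (u j) := fun j => by
    rw [hudef]; exact hdec.nsRescale (Real.exp_pos _)
  have hPu : ∀ j : ℕ, P (τ / Real.exp (j : ℝ) ^ 2) (u j) := fun j => by
    rw [hudef]; exact hscale V _ τ (Real.exp_pos _) hP
  obtain ⟨ψ, hψ, W, hW, hunif, hpt, hgr⟩ := Compactness.seqLimit hu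
  have hψt : Tendsto ψ atTop atTop := hψ.tendsto_atTop
  have hψr : Tendsto (fun j => ((ψ j : ℕ) : ℝ)) atTop atTop := tendsto_natCast_atTop_atTop.comp hψt
  have hdW : HasTypeIDecay C W := fun t ht x =>
    le_of_tendsto (hpt t ht x).norm (Eventually.of_forall fun j => hdu (ψ j) t ht x)
  -- thresholds `τ e^{−2ψ_j} → 0⁻`
  have hτneg : ∀ j, τ / Real.exp ((ψ j : ℕ) : ℝ) ^ 2 < 0 := fun j => div_neg_of_neg_of_pos hτ (by positivity)
  have hτ0 : Tendsto (fun j => τ / Real.exp ((ψ j : ℕ) : ℝ) ^ 2) atTop (𝓝 0) := by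
    have h2 : Tendsto (fun j => Real.exp ((ψ j : ℕ) : ℝ) ^ 2) atTop atTop :=
      (tendsto_pow_atTop two_ne_zero).comp (Real.tendsto_exp_atTop.comp hψr)
    exact h2.const_div_atTop τ
  have hPW : Pinf W := hclosed (fun j => u (ψ j)) W (fun j => τ / Real.exp ((ψ j : ℕ) : ℝ) ^ 2)
    (fun j => hu _) (fun j => hdu _) (fun j => hPu _) hτneg hτ0 hW hunif hpt hgr
  -- every slice enstrophy of `W` equals `m`
  have hZW : ∀ σ : ℝ, (∫ y, ‖lerayVorticity W σ y‖ ^ 2) = m := by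
    intro σ
    obtain ⟨c, hcdef⟩ : ∃ c : ℝ, c = Real.exp (-σ / 2) := ⟨_, rfl⟩
    have hc : 0 < c := by rw [hcdef]; exact Real.exp_pos _
    have hlogc : 2 * Real.log c = -σ := by rw [hcdef, Real.log_exp]; ring
    have hc2 : c ^ 2 * (-1) < 0 := by
      have : 0 < c ^ 2 := by positivity
      linarith
    obtain ⟨u', hu'def⟩ : ∃ u' : ℕ → ℝ → EuclideanSpace ℝ (Fin 3) → EuclideanSpace ℝ (Fin 3),
        ∀ j, u' j = nsRescale c (u (ψ j)) := ⟨_, fun j => rfl⟩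
    have hu' : ∀ j, IsTypeIAncientMild C (u' j) := fun j => by
      rw [hu'def]; exact (hu (ψ j)).nsRescale hc
    have hdu' : ∀ j, HasTypeIDecay C (u' j) := fun j => by
      rw [hu'def]; exact (hdu (ψ j)).nsRescale hc
    have hgr' : ∀ x, Tendsto (fun j => fderiv ℝ (u' j (-1)) x) atTop
        (𝓝 (fderiv ℝ (nsRescale c W (-1)) x)) := by
      intro x
      simp only [hu'def, fderiv_nsRescale]
      exact (hgr _ hc2 (c • x)).const_smul (c * c)
    have hlim := tendsto_integral_sq_norm_curl_neg_one hu' hdu' hgr'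
    have e1 : ∀ j, (∫ x, ‖curl (u' j (-1)) x‖ ^ 2) = Z (σ - 2 * ((ψ j : ℕ) : ℝ)) := by
      intro j
      rw [← enstrophy_zero_eq, hu'def, enstrophy_nsRescale hc, hudef,
        enstrophy_nsRescale (Real.exp_pos _), Real.log_exp, hlogc, hZσ]
      congr 2
      ring
    have e2 : (∫ x, ‖curl (nsRescale c W (-1)) x‖ ^ 2) = ∫ y, ‖lerayVorticity W σ y‖ ^ 2 := by
      rw [← enstrophy_zero_eq, enstrophy_nsRescale hc, hlogc, zero_sub, neg_neg]
    rw [e2] at hlim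
    simp_rw [e1] at hlim
    have harg : Tendsto (fun j => σ - 2 * ((ψ j : ℕ) : ℝ)) atTop atBot := by
      have h2 : Tendsto (fun j => (-2) * ((ψ j : ℕ) : ℝ)) atTop atBot :=
        hψr.const_mul_atTop_of_neg (by norm_num)
      refine (tendsto_atBot_add_const_left atTop σ h2).congr fun j => ?_
      ring
    exact tendsto_nhds_unique hlim (hm.comp harg)
  -- the limit vanishes, so `m = 0`
  have hW0 : ∀ t < 0, ∀ x, W t x = 0 := hconst W hW hdW hPW fun s s' => by rw [hZW s, hZW s']
  have hm0 : m = 0 := by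
    rw [← hZW 0, enstrophy_zero_eq]
    have : W (-1) = fun _ => 0 := funext fun x => hW0 (-1) (by norm_num) x
    simp [this, curl_eq_curlCLM]
  -- so the vorticity vanishes for `s ≤ s₀`, i.e. for `t ≤ τ`
  have hΩ0 : ∀ s, s ≤ s₀ → ∀ y, lerayVorticity V s y = 0 := by
    intro s hs
    have hcΩ : Continuous (lerayVorticity V s) := (contDiff_lerayVorticity_slice hV s).continuous
    have hE : ∫ y, ‖lerayVorticity V s y‖ ^ 2 = 0 := by
      have h1 := hmle s hs
      rw [hm0, hZσ] at h1
      exact le_antisymm h1 (integral_nonneg fun y => sq_nonneg _)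
    have hae : (fun y => ‖lerayVorticity V s y‖ ^ 2) =ᵐ[volume] 0 :=
      (integral_eq_zero_iff_of_nonneg (fun y => sq_nonneg _)
        (integrable_norm_lerayVorticity_sq hV hD1 s)).1 hE
    have hev : (fun y => ‖lerayVorticity V s y‖ ^ 2) = fun _ => (0 : ℝ) :=
      ((hcΩ.norm.pow 2).ae_eq_iff_eq (μ := volume) continuous_const).1 hae
    intro y
    have hy := congrFun hev y
    have : ‖lerayVorticity V s y‖ = 0 := pow_eq_zero_iff (n := 2) (by norm_num) |>.1 hy
    exact norm_eq_zero.1 this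
  have hcurl : ∀ t : ℝ, t ≤ τ → ∀ x, curl (V t) x = 0 := by
    intro t htτ x
    have ht : t < 0 := lt_of_le_of_lt htτ hτ
    set s : ℝ := -Real.log (-t) with hs
    have hts : -Real.exp (-s) = t := by
      rw [hs, neg_neg, Real.exp_log (neg_pos.2 ht), neg_neg]
    have hss₀ : s ≤ s₀ := by
      rw [hs, hs₀]
      exact neg_le_neg (Real.log_le_log (neg_pos.2 hτ) (by linarith))
    have h := hΩ0 s hss₀ ((Real.exp (-s / 2))⁻¹ • x)
    rw [lerayVorticity_apply, curl_lerayOrbit, smul_smul,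
      mul_inv_cancel₀ (Real.exp_pos _).ne', one_smul, hts, smul_eq_zero] at h
    exact h.resolve_left (Real.exp_pos _).ne'
  have hconstV : ∀ t : ℝ, t ≤ τ → ∀ x, V t x = V t 0 := fun t htτ x =>
    eq_of_curl_eq_zero_of_isDivFree_of_bounded
      ((hV.contDiff_slice (lt_of_le_of_lt htτ hτ)).of_le (by norm_cast))
      (hcurl t htτ) (hV.isDivFree (lt_of_le_of_lt htτ hτ))
      (fun z => hV.norm_le (lt_of_le_of_lt htτ hτ) z) x 0
  exact eq_zero_of_const_slices_until hV hτ hconstV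

end Summit.NavierStokesRegularity.NavierStokesRegularity.Theorems.FiniteDissipationLiouville.EndpointScheme

end
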